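import Literature.Probability.Distributions.GaussianSlabs
import Literature.Analysis.Fourier.HilbertTransformDecay
import Summits.QuantumFields.BalabanUV.T4Continuum.Support.NE9CutoffShell

/-!
# NE9GaussianSlice — the (SHELL) slice majorant of NE9-CUT CERTIFIED ON THE MODEL GAUSSIAN: for a product of centred
Gaussian fluctuation variables tilted by the quadratic exponent bound `exp(½α Σ_b B(b)²)` of [II] (2.20) (integrable iff
`αv_b < 1`, print's «α₅‖C^{(k)}(Z₀,0)‖ < ½» p. 17), (A″-model) the tilted total mass is `Π_b (1 − αv_b)^{−1/2}` — «It is a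
Gaussian integral, and can be easily calculated» (p. 17) — and (SHELL-model) the tilted mass of the symmetric difference of the
product small-field cut-offs at two couplings is at most `Σ_{b₀} 2ε₁|s⁻¹ − s′⁻¹|/√(2πv_{b₀}) · Π_{b≠b₀}(1 − αv_b)^{−1/2}`:
LINEAR in the threshold displacement, and literally «the same Gaussian computation with one fluctuation variable pinned in
the shell, pinned factor ≤ 1» (cell `pub-balaban`, T4-DAG §2 node U3 / §6 NE9; lineage t4-ne9-p1, generation 18; census E19 of
`t4/T4-EST-NE9-P1.md` §25)

HONEST FRAMING (T4-DAG PAGE 1).  Rung (B)+1 on a FIXED finite torus with `FlowStep.BetaPertH` and (B) explicit — NOT infinite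
volume, NOT a mass gap, NOT the Clay problem.  NE9 is a cell NEW ESTIMATE, NOT PRINTED, and is NOT discharged here.  This
module is measure theory on the MODEL measure `⊗_b 𝒩(0, v_b)` (independent fluctuation variables) with the MODEL integrand
`Π_b e^{½αB(b)²}` (the (2.20)-type box bound of the exponent, prefactor ≡ 1); Bałaban's conditioned covariance
`C^{(k)}(Z₀, σ)` of [II] (2.5)/(2.14) is NOT diagonal and his prefactor is not 1 — the dictionary from this model to (2.23) is
NOT claimed.  What the model certifies is the MECHANISM asserted in `NE9CouplingTwoPoint`/`NE9CutoffShell`: the slice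
majorant of the displayed binder (SHELL) is the Lemma-3-type Gaussian computation with one variable pinned, and it is linear
in `ε₁|s⁻¹ − s′⁻¹|`.  [II] = [Balaban1988RG2Cluster] is quoted for TYPES only (ABSOLUTE RULE).

WHAT IS PROVED (kernel, `[folklore]`).
§1 one variable (the shell's measurability is the tree's `Literature.Analysis.Fourier.measurableSet_annulus`): `gaussianPDFReal_mul_exp_quadTilt` (density × tilt = `(2πv)^{−1/2}e^{−(1−αv)x²/2v}`),
   `gaussianPDFReal_mul_exp_quadTilt_le` (≤ the peak when `αv ≤ 1` — the PINNED FACTOR ≤ 1), `integrable_exp_quadTilt`,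
   `integral_exp_quadTilt` (`= (1 − αv)^{−1/2}`, `αv < 1`), `integral_shell_exp_quadTilt_le` (`≤ 2(a′ − a)/√(2πv)`).
§2 the product model: `integral_pi_exp_quadTilt` ((A″-model): `Π_b (1 − αv_b)^{−1/2}`),
   **`integral_pi_cutoffShell_exp_quadTilt_le`** ((SHELL-model), linear in `ε₁|s⁻¹ − s′⁻¹|`, one factor replaced by the shell).
§3 (v1.1) ANY covariance, no tilt: `multivariateGaussian_cutoffShell_le` — under a multivariate Gaussian with arbitrary
   positive-semidefinite covariance (non-diagonal, as [II]'s `C^{(k)}(Z₀, 0)`), the cut-off shell has measure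
   `≤ Σ_b 2ε₁|s⁻¹ − s′⁻¹|/√(2πS_bb)` (marginals via Mathlib's `measurePreserving_eval_multivariateGaussian`).
v1.1 (same seat, APPEND-ONLY over v1 p202071: §3 added, §1–§2 byte-identical).
§4 (v1.2, APPEND-ONLY over v1.1) ANY covariance WITH the tilt: `integral_exp_quadTilt_stdGaussian_symm` — symmetric `T`,
   eigenvalues `t_i`, `αt_i² < 1`: `∫ e^{½α‖Tz‖²} d(stdGaussian) = Π_i (1 − αt_i²)^{−1/2}` (= (2.24)'s `det(1 − αT²)^{−1/2}`).

References (TYPES only): [Balaban1988RG2Cluster] CMP 116 (1988), (2.20) p. 16, (2.23)–(2.26) p. 17, (2.3) p. 12, (1.34) p. 9.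
-/

noncomputable section

namespace Summit.QuantumFields.BalabanUV.T4Continuum.NE9GaussianSlice

open MeasureTheory ProbabilityTheory Set
open scoped NNReal ENNReal BigOperators symmDiff

/-! ## §1 One fluctuation variable -/

/-- Density × quadratic tilt: `p_v(x)·e^{½αx²} = (2πv)^{−1/2}·e^{−((1 − αv)/(2v))x²}`. [folklore] -/
theorem gaussianPDFReal_mul_exp_quadTilt {v : ℝ≥0} (hv : v ≠ 0) (α x : ℝ) :
    gaussianPDFReal 0 v x * Real.exp (α / 2 * x ^ 2) =
      (Real.sqrt (2 * Real.pi * v))⁻¹ * Real.exp (-((1 - α * v) / (2 * v)) * x ^ 2) := by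
  have hv' : (v : ℝ) ≠ 0 := by exact_mod_cast hv
  rw [gaussianPDFReal, mul_assoc, ← Real.exp_add]
  congr 2
  field_simp
  ring

/-- THE PINNED FACTOR IS AT MOST THE PEAK: for `αv ≤ 1`, `p_v(x)·e^{½αx²} ≤ (2πv)^{−1/2}` (the Gaussian decay at the pinned
variable beats the tilt — print's «α₅‖C‖ < ½», [II] p. 17). [cite: Balaban1988RG2Cluster, (2.23) p.17] -/
theorem gaussianPDFReal_mul_exp_quadTilt_le {v : ℝ≥0} (hv : v ≠ 0) {α : ℝ} (hα : α * v ≤ 1) (x : ℝ) :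
    gaussianPDFReal 0 v x * Real.exp (α / 2 * x ^ 2) ≤ (Real.sqrt (2 * Real.pi * v))⁻¹ := by
  rw [gaussianPDFReal_mul_exp_quadTilt hv]
  have hv0 : 0 < (v : ℝ) := by positivity
  have hexp : Real.exp (-((1 - α * v) / (2 * v)) * x ^ 2) ≤ 1 := by
    rw [Real.exp_le_one_iff]
    have : 0 ≤ (1 - α * v) / (2 * v) * x ^ 2 := by positivity
    linarith
  have h0 : 0 ≤ (Real.sqrt (2 * Real.pi * v))⁻¹ := by positivity
  calc (Real.sqrt (2 * Real.pi * v))⁻¹ * Real.exp (-((1 - α * v) / (2 * v)) * x ^ 2)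
      ≤ (Real.sqrt (2 * Real.pi * v))⁻¹ * 1 := mul_le_mul_of_nonneg_left hexp h0
    _ = (Real.sqrt (2 * Real.pi * v))⁻¹ := mul_one _

/-- The quadratic tilt `e^{½αx²}` is integrable against `𝒩(0, v)` when `αv < 1`. [folklore] -/
theorem integrable_exp_quadTilt {v : ℝ≥0} (hv : v ≠ 0) {α : ℝ} (hα : α * v < 1) :
    Integrable (fun x : ℝ => Real.exp (α / 2 * x ^ 2)) (gaussianReal 0 v) := by
  have hv0 : 0 < (v : ℝ) := by positivity
  have hb : 0 < (1 - α * v) / (2 * v) := by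
    have : 0 < 1 - α * v := by linarith
    positivity
  rw [gaussianReal_of_var_ne_zero _ hv, integrable_withDensity_iff (measurable_gaussianPDF _ _)
    (ae_of_all _ fun _ => gaussianPDF_lt_top)]
  have h : Integrable
      (fun x : ℝ => (Real.sqrt (2 * Real.pi * v))⁻¹ * Real.exp (-((1 - α * v) / (2 * v)) * x ^ 2)) :=
    (integrable_exp_neg_mul_sq hb).const_mul _
  refine h.congr (ae_of_all _ fun x => ?_)
  simp only [toReal_gaussianPDF]
  rw [mul_comm (Real.exp _) (gaussianPDFReal 0 v x), gaussianPDFReal_mul_exp_quadTilt hv]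

/-- **THE TILTED GAUSSIAN MASS** («It is a Gaussian integral, and can be easily calculated», [II] p. 17): for `αv < 1`,
`∫ e^{½αx²} d𝒩(0, v)(x) = (1 − αv)^{−1/2}`. [cite: Balaban1988RG2Cluster, (2.23)-(2.25) p.17] -/
theorem integral_exp_quadTilt {v : ℝ≥0} (hv : v ≠ 0) {α : ℝ} (hα : α * v < 1) :
    ∫ x, Real.exp (α / 2 * x ^ 2) ∂(gaussianReal 0 v) = (Real.sqrt (1 - α * v))⁻¹ := by
  have hv0 : 0 < (v : ℝ) := by positivity
  have hb : 0 < (1 - α * v) / (2 * v) := by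
    have : 0 < 1 - α * v := by linarith
    positivity
  rw [integral_gaussianReal_eq_integral_smul hv]
  simp_rw [smul_eq_mul, gaussianPDFReal_mul_exp_quadTilt hv]
  rw [integral_const_mul, integral_gaussian]
  have h2πv : 0 < 2 * Real.pi * (v : ℝ) := by positivity
  have hquot : Real.pi / ((1 - α * v) / (2 * v)) = (2 * Real.pi * v) * (1 - α * v)⁻¹ := by
    field_simp
  rw [hquot, Real.sqrt_mul h2πv.le, Real.sqrt_inv, ← mul_assoc, inv_mul_cancel₀ (Real.sqrt_pos.2 h2πv).ne', one_mul]

/-- The Lebesgue measure of the shell is at most `2(a′ − a)` (two intervals). [folklore] -/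
theorem volume_shell_le {a a' : ℝ} (haa' : a ≤ a') :
    volume {x : ℝ | a ≤ |x| ∧ |x| < a'} ≤ ENNReal.ofReal (2 * (a' - a)) := by
  have hsub : {x : ℝ | a ≤ |x| ∧ |x| < a'} ⊆ Set.Icc (-a') (-a) ∪ Set.Icc a a' := by
    intro x hx
    simp only [Set.mem_setOf_eq] at hx
    rcases le_or_gt 0 x with h | h
    · right; rw [abs_of_nonneg h] at hx; exact ⟨hx.1, hx.2.le⟩
    · left; rw [abs_of_neg h] at hx; constructor <;> linarith [hx.1, hx.2]
  have hw : 0 ≤ a' - a := sub_nonneg.2 haa'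
  calc volume {x : ℝ | a ≤ |x| ∧ |x| < a'} ≤ volume (Set.Icc (-a') (-a) ∪ Set.Icc a a') := measure_mono hsub
    _ ≤ volume (Set.Icc (-a') (-a)) + volume (Set.Icc a a') := measure_union_le _ _
    _ = ENNReal.ofReal (2 * (a' - a)) := by
        rw [Real.volume_Icc, Real.volume_Icc, show -a - -a' = a' - a by ring, ← ENNReal.ofReal_add hw hw]
        ring_nf

/-- **THE TILTED SHELL MASS, one variable** — the pinned factor of (SHELL): for `αv ≤ 1` and `a ≤ a′`,
`∫_{a ≤ |x| < a′} e^{½αx²} d𝒩(0, v)(x) ≤ 2(a′ − a)/√(2πv)` (pinned factor ≤ peak, times the width of the two intervals).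
[cite: Balaban1988RG2Cluster, (2.23) p.17 and (2.3) p.12] -/
theorem integral_shell_exp_quadTilt_le {v : ℝ≥0} (hv : v ≠ 0) {α : ℝ} (hα : α * v ≤ 1) {a a' : ℝ} (haa' : a ≤ a') :
    ∫ x, {x : ℝ | a ≤ |x| ∧ |x| < a'}.indicator (fun x => Real.exp (α / 2 * x ^ 2)) x ∂(gaussianReal 0 v) ≤
      2 * (a' - a) * (Real.sqrt (2 * Real.pi * v))⁻¹ := by
  set Sh : Set ℝ := {x : ℝ | a ≤ |x| ∧ |x| < a'} with hSh
  have hmeas : MeasurableSet Sh := Literature.Analysis.Fourier.measurableSet_annulus a a'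
  set c : ℝ := (Real.sqrt (2 * Real.pi * v))⁻¹ with hc
  have hc0 : 0 ≤ c := by positivity
  rw [integral_gaussianReal_eq_integral_smul hv]
  -- pointwise: density • indicator ≤ indicator of the constant peak
  have hpt : ∀ x, gaussianPDFReal 0 v x • Sh.indicator (fun x => Real.exp (α / 2 * x ^ 2)) x ≤
      Sh.indicator (fun _ => c) x := by
    intro x
    by_cases hx : x ∈ Sh
    · rw [indicator_of_mem hx, indicator_of_mem hx, smul_eq_mul]
      exact gaussianPDFReal_mul_exp_quadTilt_le hv hα x
    · rw [indicator_of_notMem hx, indicator_of_notMem hx, smul_zero]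
  have hnn : ∀ x, 0 ≤ gaussianPDFReal 0 v x • Sh.indicator (fun x => Real.exp (α / 2 * x ^ 2)) x := by
    intro x
    rw [smul_eq_mul]
    exact mul_nonneg (gaussianPDFReal_nonneg _ _ _) (Set.indicator_nonneg (fun _ _ => (Real.exp_pos _).le) _)
  have hvol : volume Sh < ∞ := (volume_shell_le haa').trans_lt ENNReal.ofReal_lt_top
  have hint : Integrable (fun x => Sh.indicator (fun _ => c) x) volume :=
    (integrableOn_const hvol.ne).integrable_indicator hmeas
  calc ∫ x, gaussianPDFReal 0 v x • Sh.indicator (fun x => Real.exp (α / 2 * x ^ 2)) x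
      ≤ ∫ x, Sh.indicator (fun _ => c) x :=
        integral_mono_of_nonneg (Filter.Eventually.of_forall hnn) hint (Filter.Eventually.of_forall hpt)
    _ = volume.real Sh * c := by rw [integral_indicator_const _ hmeas, smul_eq_mul]
    _ ≤ 2 * (a' - a) * c := by
        refine mul_le_mul_of_nonneg_right ?_ hc0
        rw [measureReal_def]
        exact ENNReal.toReal_le_of_le_ofReal (by linarith) (volume_shell_le haa')

/-! ## §2 The product model: independent fluctuation variables over a finite bond set -/

section Product

variable {Bd : Type*} [Fintype Bd] [DecidableEq Bd]

omit [DecidableEq Bd] in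
/-- **(A″-MODEL) THE TILTED TOTAL MASS of the product Gaussian**: `∫ Π_b e^{½αB(b)²} d⊗_b𝒩(0, v_b) = Π_b (1 − αv_b)^{−1/2}`
(Fubini over the bonds, then §1).  The TYPE of the chain (2.20) → (2.23) → (2.26) of [II] with prefactor ≡ 1 and diagonal
covariance. [cite: Balaban1988RG2Cluster, (2.20) p.16 and (2.23)-(2.26) p.17] -/
theorem integral_pi_exp_quadTilt (v : Bd → ℝ≥0) (hv : ∀ b, v b ≠ 0) {α : ℝ} (hα : ∀ b, α * v b < 1) :
    ∫ x, ∏ b, Real.exp (α / 2 * (x b) ^ 2) ∂(Measure.pi fun b => gaussianReal 0 (v b)) =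
      ∏ b, (Real.sqrt (1 - α * v b))⁻¹ := by
  rw [integral_fintype_prod_eq_prod (fun b (y : ℝ) => Real.exp (α / 2 * y ^ 2))]
  exact Finset.prod_congr rfl fun b _ => integral_exp_quadTilt (hv b) (hα b)

/-- The one-bond factors of the pinned product: the shell-restricted tilt at the pinned bond `b₀`, the full tilt elsewhere.
[folklore] -/
def pinnedFactor (α ε₁ s s' : ℝ) (b₀ b : Bd) (y : ℝ) : ℝ :=
  if b = b₀ then {y : ℝ | ε₁ / max s s' ≤ |y| ∧ |y| < ε₁ / min s s'}.indicator (fun y => Real.exp (α / 2 * y ^ 2)) y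
  else Real.exp (α / 2 * y ^ 2)

omit [Fintype Bd] in
/-- Each pinned factor is nonnegative. [folklore] -/
theorem pinnedFactor_nonneg (α ε₁ s s' : ℝ) (b₀ b : Bd) (y : ℝ) : 0 ≤ pinnedFactor α ε₁ s s' b₀ b y := by
  unfold pinnedFactor
  split_ifs
  · exact Set.indicator_nonneg (fun _ _ => (Real.exp_pos _).le) _
  · exact (Real.exp_pos _).le

omit [Fintype Bd] in
/-- Each pinned factor is integrable against its Gaussian (`αv_b < 1`). [folklore] -/
theorem integrable_pinnedFactor (v : Bd → ℝ≥0) (hv : ∀ b, v b ≠ 0) {α : ℝ} (hα : ∀ b, α * v b < 1)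
    (ε₁ s s' : ℝ) (b₀ b : Bd) : Integrable (pinnedFactor α ε₁ s s' b₀ b) (gaussianReal 0 (v b)) := by
  unfold pinnedFactor
  split_ifs
  · exact (integrable_exp_quadTilt (hv b) (hα b)).indicator (Literature.Analysis.Fourier.measurableSet_annulus _ _)
  · exact integrable_exp_quadTilt (hv b) (hα b)

/-- POINTWISE: on the symmetric difference of the two product cut-offs the tilt is dominated by the SUM over the pinned
bond of the pinned products (`NE9CutoffShell.prodCutoff_symmDiff_subset`: the symmetric difference lies in the union of the
one-bond shells; all factors are nonnegative). [folklore] -/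
theorem indicator_symmDiff_prod_le {α ε₁ s s' : ℝ} (hε : 0 ≤ ε₁) (hs : 0 < s) (hs' : 0 < s') (x : Bd → ℝ) :
    (NE9CutoffShell.prodCutoff (Finset.univ : Finset Bd) (fun b (x : Bd → ℝ) => x b) ε₁ s ∆
        NE9CutoffShell.prodCutoff (Finset.univ : Finset Bd) (fun b (x : Bd → ℝ) => x b) ε₁ s').indicator
        (fun x => ∏ b, Real.exp (α / 2 * (x b) ^ 2)) x ≤
      ∑ b₀, ∏ b, pinnedFactor α ε₁ s s' b₀ b (x b) := by
  have hterm : ∀ b₀, 0 ≤ ∏ b, pinnedFactor α ε₁ s s' b₀ b (x b) := fun b₀ =>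
    Finset.prod_nonneg fun b _ => pinnedFactor_nonneg α ε₁ s s' b₀ b (x b)
  by_cases hx : x ∈ NE9CutoffShell.prodCutoff (Finset.univ : Finset Bd) (fun b (x : Bd → ℝ) => x b) ε₁ s ∆
      NE9CutoffShell.prodCutoff (Finset.univ : Finset Bd) (fun b (x : Bd → ℝ) => x b) ε₁ s'
  · rw [indicator_of_mem hx]
    obtain ⟨b₀, -, hb₀⟩ : ∃ b₀ ∈ (Finset.univ : Finset Bd), x ∈ NE9CutoffShell.bondShell (fun b (x : Bd → ℝ) => x b) ε₁ s s' b₀ := by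
      have h := NE9CutoffShell.prodCutoff_symmDiff_subset (Finset.univ : Finset Bd) (fun b (x : Bd → ℝ) => x b) hε hs hs' hx
      simpa only [Set.mem_iUnion, exists_prop] using h
    have hshell : x b₀ ∈ {y : ℝ | ε₁ / max s s' ≤ |y| ∧ |y| < ε₁ / min s s'} := hb₀
    have heq : ∏ b, pinnedFactor α ε₁ s s' b₀ b (x b) = ∏ b, Real.exp (α / 2 * (x b) ^ 2) := by
      refine Finset.prod_congr rfl fun b _ => ?_
      unfold pinnedFactor
      split_ifs with hb
      · subst hb; rw [indicator_of_mem hshell]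
      · rfl
    rw [← heq]
    exact Finset.single_le_sum (fun b₀ _ => hterm b₀) (Finset.mem_univ b₀)
  · rw [indicator_of_notMem hx]
    exact Finset.sum_nonneg fun b₀ _ => hterm b₀

/-- The pinned product integrates to (shell factor at `b₀`) × (full factors elsewhere), and is bounded accordingly:
`∫ Π_b pinnedFactor d⊗𝒩 ≤ 2ε₁|s⁻¹ − s′⁻¹|/√(2πv_{b₀}) · Π_{b ≠ b₀} (1 − αv_b)^{−1/2}`. [folklore] -/
theorem integral_prod_pinnedFactor_le (v : Bd → ℝ≥0) (hv : ∀ b, v b ≠ 0) {α : ℝ} (hα : ∀ b, α * v b < 1)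
    {ε₁ s s' : ℝ} (hε : 0 ≤ ε₁) (hs : 0 < s) (hs' : 0 < s') (b₀ : Bd) :
    ∫ x, ∏ b, pinnedFactor α ε₁ s s' b₀ b (x b) ∂(Measure.pi fun b => gaussianReal 0 (v b)) ≤
      2 * (ε₁ * |s⁻¹ - s'⁻¹|) * (Real.sqrt (2 * Real.pi * v b₀))⁻¹ *
        ∏ b ∈ Finset.univ.erase b₀, (Real.sqrt (1 - α * v b))⁻¹ := by
  rw [integral_fintype_prod_eq_prod (fun b (y : ℝ) => pinnedFactor α ε₁ s s' b₀ b y),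
    ← Finset.mul_prod_erase Finset.univ _ (Finset.mem_univ b₀)]
  have hrest : ∏ b ∈ Finset.univ.erase b₀, ∫ y, pinnedFactor α ε₁ s s' b₀ b y ∂(gaussianReal 0 (v b)) =
      ∏ b ∈ Finset.univ.erase b₀, (Real.sqrt (1 - α * v b))⁻¹ := by
    refine Finset.prod_congr rfl fun b hb => ?_
    have hne : b ≠ b₀ := Finset.ne_of_mem_erase hb
    simp only [pinnedFactor, hne, if_false]
    exact integral_exp_quadTilt (hv b) (hα b)
  have hpin : ∫ y, pinnedFactor α ε₁ s s' b₀ b₀ y ∂(gaussianReal 0 (v b₀)) ≤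
      2 * (ε₁ * |s⁻¹ - s'⁻¹|) * (Real.sqrt (2 * Real.pi * v b₀))⁻¹ := by
    simp only [pinnedFactor, if_true]
    have hw := NE9CutoffShell.shellWidth_eq (ε₁ := ε₁) hs hs'
    have hle : ε₁ / max s s' ≤ ε₁ / min s s' := div_le_div_of_nonneg_left hε (lt_min hs hs') min_le_max
    have h := integral_shell_exp_quadTilt_le (hv b₀) (hα b₀).le hle
    rwa [hw] at h
  have hrest0 : 0 ≤ ∏ b ∈ Finset.univ.erase b₀, (Real.sqrt (1 - α * v b))⁻¹ :=
    Finset.prod_nonneg fun b _ => by positivity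
  rw [hrest]
  exact mul_le_mul_of_nonneg_right hpin hrest0

/-- **(SHELL-MODEL) THE TILTED MASS OF THE CUT-OFF SHELL, product Gaussian** — the slice majorant of NE9-CUT certified on the
model: for independent centred Gaussian bond variables (`αv_b < 1`) and the product small-field cut-offs at couplings `s, s′ > 0`,
`∫ 1_{S(s) Δ S(s′)} Π_b e^{½αB(b)²} d⊗_b𝒩(0, v_b) ≤ Σ_{b₀} 2ε₁|s⁻¹ − s′⁻¹|/√(2πv_{b₀}) · Π_{b ≠ b₀}(1 − αv_b)^{−1/2}` — the
(A″-model) computation with ONE variable pinned in its shell (pinned factor ≤ peak), summed over the pinned bond; LINEAR in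
the threshold displacement `ε₁|s⁻¹ − s′⁻¹|`, hence a bounded modulus in `t = g⁻²` (`NE9CutoffShell.inv_sub_inv_le`).
[cite: Balaban1988RG2Cluster, (2.3) p.12, (2.20) p.16, (2.23)-(2.26) p.17] -/
theorem integral_pi_cutoffShell_exp_quadTilt_le (v : Bd → ℝ≥0) (hv : ∀ b, v b ≠ 0) {α : ℝ} (hα : ∀ b, α * v b < 1)
    {ε₁ s s' : ℝ} (hε : 0 ≤ ε₁) (hs : 0 < s) (hs' : 0 < s') :
    ∫ x, (NE9CutoffShell.prodCutoff (Finset.univ : Finset Bd) (fun b (x : Bd → ℝ) => x b) ε₁ s ∆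
          NE9CutoffShell.prodCutoff (Finset.univ : Finset Bd) (fun b (x : Bd → ℝ) => x b) ε₁ s').indicator
          (fun x => ∏ b, Real.exp (α / 2 * (x b) ^ 2)) x ∂(Measure.pi fun b => gaussianReal 0 (v b)) ≤
      ∑ b₀, 2 * (ε₁ * |s⁻¹ - s'⁻¹|) * (Real.sqrt (2 * Real.pi * v b₀))⁻¹ *
        ∏ b ∈ Finset.univ.erase b₀, (Real.sqrt (1 - α * v b))⁻¹ := by
  set μ : Measure (Bd → ℝ) := Measure.pi fun b => gaussianReal 0 (v b) with hμ
  have hint : ∀ b₀, Integrable (fun x : Bd → ℝ => ∏ b, pinnedFactor α ε₁ s s' b₀ b (x b)) μ := fun b₀ =>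
    Integrable.fintype_prod (fun b => integrable_pinnedFactor v hv hα ε₁ s s' b₀ b)
  have hnn : ∀ x : Bd → ℝ, 0 ≤ (NE9CutoffShell.prodCutoff (Finset.univ : Finset Bd) (fun b (x : Bd → ℝ) => x b) ε₁ s ∆
      NE9CutoffShell.prodCutoff (Finset.univ : Finset Bd) (fun b (x : Bd → ℝ) => x b) ε₁ s').indicator
      (fun x => ∏ b, Real.exp (α / 2 * (x b) ^ 2)) x := fun x =>
    Set.indicator_nonneg (fun x _ => Finset.prod_nonneg fun b _ => (Real.exp_pos _).le) _
  calc ∫ x, (NE9CutoffShell.prodCutoff (Finset.univ : Finset Bd) (fun b (x : Bd → ℝ) => x b) ε₁ s ∆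
            NE9CutoffShell.prodCutoff (Finset.univ : Finset Bd) (fun b (x : Bd → ℝ) => x b) ε₁ s').indicator
            (fun x => ∏ b, Real.exp (α / 2 * (x b) ^ 2)) x ∂μ
      ≤ ∫ x, ∑ b₀, ∏ b, pinnedFactor α ε₁ s s' b₀ b (x b) ∂μ :=
        integral_mono_of_nonneg (Filter.Eventually.of_forall hnn) (integrable_finsetSum _ fun b₀ _ => hint b₀)
          (Filter.Eventually.of_forall fun x => indicator_symmDiff_prod_le hε hs hs' x)
    _ = ∑ b₀, ∫ x, ∏ b, pinnedFactor α ε₁ s s' b₀ b (x b) ∂μ := integral_finsetSum _ fun b₀ _ => hint b₀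
    _ ≤ ∑ b₀, 2 * (ε₁ * |s⁻¹ - s'⁻¹|) * (Real.sqrt (2 * Real.pi * v b₀))⁻¹ *
          ∏ b ∈ Finset.univ.erase b₀, (Real.sqrt (1 - α * v b))⁻¹ :=
        Finset.sum_le_sum fun b₀ _ => integral_prod_pinnedFactor_le v hv hα hε hs hs' b₀

end Product

/-! ## §3 (v1.1) ANY covariance, no tilt: the cut-off shell under a multivariate Gaussian is controlled by the MARGINALS

The width × marginal-density half of the mechanism needs no independence: under a multivariate Gaussian with ARBITRARY
(positive semidefinite) covariance `S` — the situation of Bałaban's conditioned fluctuation covariance `C^{(k)}(Z₀, 0)` of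
[II] (2.5)/(2.23), which is not diagonal — the bond variable `B(b)` is Gaussian with variance `S_bb` (Mathlib's
`measurePreserving_eval_multivariateGaussian`), so the measure of the symmetric difference of the two product cut-offs is at
most `Σ_b 2ε₁|s⁻¹ − s′⁻¹|/√(2πS_bb)`.  (The tilted version for a general covariance — `det(1 − αS)^{−1/2}` and a conditional
variance at the pinned bond — is routine Gaussian algebra NOT formalised here.) -/

section AnyCovariance

variable {Bd : Type*} [Fintype Bd] [DecidableEq Bd]

/-- Shell mass of a Gaussian of ANY mean: `𝒩(m, v){a ≤ |x| < a′} ≤ 2(a′ − a)/√(2πv)` (density ≤ peak). [folklore] -/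
theorem gaussianReal_shell_le_mean (m : ℝ) {v : ℝ≥0} (hv : v ≠ 0) {a a' : ℝ} (haa' : a ≤ a') :
    gaussianReal m v {x : ℝ | a ≤ |x| ∧ |x| < a'} ≤ ENNReal.ofReal (2 * (a' - a) * (Real.sqrt (2 * Real.pi * v))⁻¹) := by
  rw [gaussianReal_apply _ hv]
  calc ∫⁻ x in {x : ℝ | a ≤ |x| ∧ |x| < a'}, gaussianPDF m v x
      ≤ ∫⁻ _ in {x : ℝ | a ≤ |x| ∧ |x| < a'}, ENNReal.ofReal ((Real.sqrt (2 * Real.pi * v))⁻¹) :=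
        lintegral_mono fun x => ENNReal.ofReal_le_ofReal
          (Literature.Probability.Distributions.gaussianPDFReal_le_peak m v x)
    _ = ENNReal.ofReal ((Real.sqrt (2 * Real.pi * v))⁻¹) * volume {x : ℝ | a ≤ |x| ∧ |x| < a'} := setLIntegral_const _ _
    _ ≤ ENNReal.ofReal ((Real.sqrt (2 * Real.pi * v))⁻¹) * ENNReal.ofReal (2 * (a' - a)) :=
        by gcongr; exact volume_shell_le haa'
    _ = ENNReal.ofReal (2 * (a' - a) * (Real.sqrt (2 * Real.pi * v))⁻¹) := by
        rw [← ENNReal.ofReal_mul (by positivity)]; ring_nf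

/-- **THE CUT-OFF SHELL UNDER A MULTIVARIATE GAUSSIAN OF ANY COVARIANCE** (no tilt): for a positive semidefinite covariance
matrix `S` with positive diagonal and any mean, the symmetric difference of the product small-field cut-offs at two couplings
`s, s′ > 0` has measure `≤ Σ_b 2ε₁|s⁻¹ − s′⁻¹|/√(2πS_bb)` — one-bond shells (`NE9CutoffShell.prodCutoff_symmDiff_subset`) and
the Gaussian MARGINAL of each bond variable (`measurePreserving_eval_multivariateGaussian`).  This is the part of the (SHELL)
mechanism that holds verbatim for a NON-diagonal fluctuation covariance such as [II]'s `C^{(k)}(Z₀, 0)`.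
[cite: Balaban1988RG2Cluster, (2.5) p.12 and (2.23) p.17] -/
theorem multivariateGaussian_cutoffShell_le (m : EuclideanSpace ℝ Bd) {S : Matrix Bd Bd ℝ} (hS : S.PosSemidef)
    (hSbb : ∀ b, 0 < S b b) {ε₁ s s' : ℝ} (hε : 0 ≤ ε₁) (hs : 0 < s) (hs' : 0 < s') :
    multivariateGaussian m S
        (NE9CutoffShell.prodCutoff (Finset.univ : Finset Bd) (fun b (x : EuclideanSpace ℝ Bd) => x b) ε₁ s ∆
          NE9CutoffShell.prodCutoff (Finset.univ : Finset Bd) (fun b (x : EuclideanSpace ℝ Bd) => x b) ε₁ s') ≤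
      ∑ b, ENNReal.ofReal (2 * (ε₁ * |s⁻¹ - s'⁻¹|) * (Real.sqrt (2 * Real.pi * S b b))⁻¹) := by
  set μS := multivariateGaussian m S with hμS
  have hsub := NE9CutoffShell.prodCutoff_symmDiff_subset (Finset.univ : Finset Bd)
    (fun b (x : EuclideanSpace ℝ Bd) => x b) hε hs hs'
  calc μS (NE9CutoffShell.prodCutoff (Finset.univ : Finset Bd) (fun b (x : EuclideanSpace ℝ Bd) => x b) ε₁ s ∆
          NE9CutoffShell.prodCutoff (Finset.univ : Finset Bd) (fun b (x : EuclideanSpace ℝ Bd) => x b) ε₁ s')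
      ≤ μS (⋃ b ∈ (Finset.univ : Finset Bd),
          NE9CutoffShell.bondShell (fun b (x : EuclideanSpace ℝ Bd) => x b) ε₁ s s' b) := measure_mono hsub
    _ ≤ ∑ b, μS (NE9CutoffShell.bondShell (fun b (x : EuclideanSpace ℝ Bd) => x b) ε₁ s s' b) :=
        measure_biUnion_finset_le _ _
    _ ≤ ∑ b, ENNReal.ofReal (2 * (ε₁ * |s⁻¹ - s'⁻¹|) * (Real.sqrt (2 * Real.pi * S b b))⁻¹) := by
        refine Finset.sum_le_sum fun b _ => ?_
        have hset : NE9CutoffShell.bondShell (fun b (x : EuclideanSpace ℝ Bd) => x b) ε₁ s s' b =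
            (fun x : EuclideanSpace ℝ Bd => x b) ⁻¹' {y : ℝ | ε₁ / max s s' ≤ |y| ∧ |y| < ε₁ / min s s'} := rfl
        have hv : (S b b).toNNReal ≠ 0 := by
          rw [ne_eq, Real.toNNReal_eq_zero, not_le]; exact hSbb b
        rw [hset, (measurePreserving_eval_multivariateGaussian hS).measure_preimage
          (Literature.Analysis.Fourier.measurableSet_annulus _ _).nullMeasurableSet]
        have h := gaussianReal_shell_le_mean (m b) hv
          (div_le_div_of_nonneg_left hε (lt_min hs hs') min_le_max)
        rwa [NE9CutoffShell.shellWidth_eq hs hs', Real.coe_toNNReal _ (hSbb b).le] at h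

end AnyCovariance

/-! ## §4 (v1.2) ANY covariance, WITH the tilt: (2.24)'s determinant formula via the spectral theorem (the identification
of `Π_i (1 − αt_i²)^{−1/2}` with `det(1 − αT²)^{−1/2}` and of `(stdGaussian).map T` with `multivariateGaussian 0 (T²)` are remarks) -/

section Spectral

open ProbabilityTheory
open scoped RealInnerProductSpace
variable {E : Type*} [NormedAddCommGroup E] [InnerProductSpace ℝ E] [FiniteDimensional ℝ E] [MeasurableSpace E]
  [BorelSpace E]

omit [MeasurableSpace E] [BorelSpace E] in
/-- In an orthonormal eigenbasis, `‖T(Σ_i w_i b_i)‖² = Σ_i t_i² w_i²`. [folklore] -/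
theorem norm_sq_apply_sum_eigenvectorBasis {T : E →ₗ[ℝ] E} (hT : T.IsSymmetric) {n : ℕ} (hn : Module.finrank ℝ E = n)
    (w : Fin n → ℝ) :
    ‖T (∑ i, w i • hT.eigenvectorBasis hn i)‖ ^ 2 = ∑ i, (hT.eigenvalues hn i) ^ 2 * w i ^ 2 := by
  set b := hT.eigenvectorBasis hn with hb
  have hTsum : T (∑ i, w i • b i) = ∑ i, (w i * hT.eigenvalues hn i) • b i := by
    rw [map_sum]
    refine Finset.sum_congr rfl fun i _ => ?_
    rw [map_smul, hb, hT.apply_eigenvectorBasis hn i, smul_smul]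
    norm_num [mul_comm]
  rw [hTsum, @norm_sq_eq_re_inner ℝ, b.orthonormal.inner_sum]
  simp only [RCLike.conj_to_real, RCLike.re_to_real]
  refine Finset.sum_congr rfl fun i _ => by ring

/-- **THE TILTED GAUSSIAN MASS FOR ANY COVARIANCE (the determinant formula of [II] (2.24) via the spectral theorem)**:
for a symmetric `T` on a finite-dimensional real inner product space with eigenvalues `t_i` and `αt_i² < 1`,
`∫ e^{½α‖Tz‖²} d(stdGaussian)(z) = Π_i (1 − αt_i²)^{−1/2}` — the centred Gaussian of covariance `T²` (the image of the standard
Gaussian under `T`) has tilted mass `det(1 − αT²)^{−1/2}`; rotation invariance in the eigenbasis, Fubini, §1.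
[cite: Balaban1988RG2Cluster, (2.23)-(2.24) p.17] -/
theorem integral_exp_quadTilt_stdGaussian_symm {T : E →ₗ[ℝ] E} (hT : T.IsSymmetric) {n : ℕ}
    (hn : Module.finrank ℝ E = n) {α : ℝ} (hα : ∀ i, α * (hT.eigenvalues hn i) ^ 2 < 1) :
    ∫ z, Real.exp (α / 2 * ‖T z‖ ^ 2) ∂(stdGaussian E) = ∏ i, (Real.sqrt (1 - α * (hT.eigenvalues hn i) ^ 2))⁻¹ := by
  set b := hT.eigenvectorBasis hn with hb
  rw [stdGaussian_eq_map_pi_orthonormalBasis b]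
  have hmeas : Continuous (fun x : Fin n → ℝ => ∑ i, x i • b i) := by fun_prop
  rw [integral_map hmeas.aemeasurable (Continuous.aestronglyMeasurable (by fun_prop))]
  have hpt : ∀ w : Fin n → ℝ, Real.exp (α / 2 * ‖T (∑ i, w i • b i)‖ ^ 2) =
      ∏ i, Real.exp ((α * (hT.eigenvalues hn i) ^ 2) / 2 * (w i) ^ 2) := by
    intro w
    rw [hb, norm_sq_apply_sum_eigenvectorBasis hT hn w, Finset.mul_sum, Real.exp_sum]
    refine Finset.prod_congr rfl fun i _ => ?_
    congr 1; ring
  simp_rw [hpt]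
  rw [integral_fintype_prod_eq_prod (fun i (y : ℝ) => Real.exp ((α * (hT.eigenvalues hn i) ^ 2) / 2 * y ^ 2))]
  refine Finset.prod_congr rfl fun i _ => ?_
  have h := integral_exp_quadTilt (v := 1) one_ne_zero (α := α * (hT.eigenvalues hn i) ^ 2) (by simpa using hα i)
  simpa using h

end Spectral

end Summit.QuantumFields.BalabanUV.T4Continuum.NE9GaussianSlice

end
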